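import Summits.CriticalPhenomena.PercolationContinuityZ3.Theorems.PercNearOneGluingNoHeavyLowerTailStarSetLevelTwo
import Summits.CriticalPhenomena.PercolationContinuityZ3.Theorems.PercNearOneGluingNoHeavyLowerTailCILStarTransfer
import Summits.CriticalPhenomena.PercolationContinuityZ3.Theorems.PercNearOneGluingNoHeavyLowerTailCILRelayNeighboursHolds
import HarnessLib

/-!
# `NoHeavyLowerTail` (stmt-CriticalPhenomena-4575) — OES for two-port star SETS (finset form) and CIL at level `j ≤ 2` for observers
# whose Steiner neighbours are two-port pendant stars

Support file (prover `prim-gen-swap` gen 7; `--supports stmt-CriticalPhenomena-4575`).  No definitions, no named facts, no sorries.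

* `StarSet.setCS_twoPortStarSet_levelTwo` — `StarSet.setCS_twoPortStars_levelTwo` for a FINSET `B` of star centres with port maps
  `p p' : Fin n → Fin n` (the statement of the seat blueprint `setCS_twoPortStars_levelTwo`, R3-SEATS.md §7): at `j ≤ 2`, for any number
  of two-port pendant stars with pairwise distinct ports and a relay `c` off the ports dominating them, `CS_w(B, c)`.
* `StarSet.cil_twoPortStars_levelTwo` — **CIL_j (`j ≤ 2`, every `|A|`) at an observer `o ∉ A` whose non-relay neighbours are two-port
  pendant stars with pairwise distinct ports (any number of them, any relay neighbours, arbitrary graph elsewhere), with the witness an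
  `H`-champion `q ∈ A` (`H = G − o`) that is not a port**: `μ(1 ≤ |π(o)| ≤ j) ≤ μ(|π(q)| ≤ j)`.  Proof: prim-gen-induct's star transfer
  `cil_of_starStability` asks for `CS_H(B, q)` on every set `B` of light neighbours; light neighbours are stars (relays are dominated by
  the champion), and `CS_H(B, q)` is `setCS_twoPortStarSet_levelTwo` in the graph `H` (`CutObserver.measureReal_preimage_avoid`).
  (The case of a champion that IS a port of a star needs a separate pivot on that port pair and is not treated here.)
-/

noncomputable section

namespace Summit.CriticalPhenomena.PercolationContinuityZ3.Theorems

open MeasureTheory Set Literature.Probability.LatticeModels Literature.Probability.Percolation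
open scoped Classical BigOperators

variable {n : ℕ}

namespace StarSet

/-- **OES at level `j ≤ 2` for a finset of two-port pendant stars with pairwise distinct ports.**  `B` = the star centres (`∉ A`), star
`y` has ports `p y ≠ p' y ∈ A` and no other positive pair, ports of different stars are different, `c ∈ A` is not a port and dominates
every port.  Conclusion: `μ(c ↮ B, 1 ≤ |π(B)| ≤ j) ≤ μ(c ↮ B, |π(c)| ≤ j)`.
[cite: VandenbergHaggstromKahn2005, Thm. 1.5 (p. 7) — via `StarSet.setCS_twoPortStars_levelTwo`] -/
theorem setCS_twoPortStarSet_levelTwo (w : Sym2 (Fin n) → unitInterval) (A B : Finset (Fin n)) (p p' : Fin n → Fin n) (c : Fin n)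
    (j : ℕ) (hj : j ≤ 2) (hBA : ∀ y ∈ B, y ∉ A)
    (hports : ∀ y ∈ B, p y ∈ A ∧ p' y ∈ A ∧ p y ≠ p' y)
    (hobs : ∀ y ∈ B, ∀ u : Fin n, u ≠ y → w s(y, u) ≠ 0 → u = p y ∨ u = p' y)
    (hdis : ∀ y ∈ B, ∀ y' ∈ B, y ≠ y' → p y ≠ p y' ∧ p y ≠ p' y' ∧ p' y ≠ p y' ∧ p' y ≠ p' y')
    (hcA : c ∈ A) (hcp : ∀ y ∈ B, c ≠ p y ∧ c ≠ p' y)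
    (hdom : ∀ y ∈ B,
      (prodBernoulli w).real {ω : BondConfig (Fin n) | (A.filter fun z => ω ∈ openConn (p y) z).card ≤ j} ≤
          (prodBernoulli w).real {ω : BondConfig (Fin n) | (A.filter fun z => ω ∈ openConn c z).card ≤ j} ∧
        (prodBernoulli w).real {ω : BondConfig (Fin n) | (A.filter fun z => ω ∈ openConn (p' y) z).card ≤ j} ≤
          (prodBernoulli w).real {ω : BondConfig (Fin n) | (A.filter fun z => ω ∈ openConn c z).card ≤ j}) :
    (prodBernoulli w).real {ω : BondConfig (Fin n) | (∀ y ∈ B, ω ∉ openConn c y) ∧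
        1 ≤ (A.filter fun z => ∃ y ∈ B, ω ∈ openConn y z).card ∧
        (A.filter fun z => ∃ y ∈ B, ω ∈ openConn y z).card ≤ j} ≤
      (prodBernoulli w).real {ω : BondConfig (Fin n) | (∀ y ∈ B, ω ∉ openConn c y) ∧
        (A.filter fun z => ω ∈ openConn c z).card ≤ j} := by
  -- enumerate the stars
  set s : Fin B.card → Fin n := fun i => (B.equivFin.symm i).val with hs_def
  have hsB : ∀ i, s i ∈ B := fun i => (B.equivFin.symm i).property
  have hs : Function.Injective s := fun i k h => B.equivFin.symm.injective (Subtype.ext h)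
  have hSB : Finset.univ.image s = B := by
    ext x
    rw [Finset.mem_image]
    constructor
    · rintro ⟨i, -, rfl⟩; exact hsB i
    · intro hx
      refine ⟨B.equivFin ⟨x, hx⟩, Finset.mem_univ _, ?_⟩
      simp only [hs_def, Equiv.symm_apply_apply]
  have h := setCS_twoPortStars_levelTwo w A s (fun i => p (s i)) (fun i => p' (s i)) c j hj hs (fun i => hBA _ (hsB i))
    (fun i => (hports _ (hsB i)).1) (fun i => (hports _ (hsB i)).2.1) (fun i => (hports _ (hsB i)).2.2)
    (fun i k hik => by
      have hd := hdis _ (hsB i) _ (hsB k) (fun h => hik (hs h))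
      exact ⟨hd.1, hd.2.1, hd.2.2.2⟩)
    hcA (fun i => hcp _ (hsB i))
    (fun i u hu hup hup' => by
      by_contra hne
      rcases hobs _ (hsB i) u hu hne with h | h
      · exact hup h
      · exact hup' h)
    (fun i => hdom _ (hsB i))
  rw [hSB] at h
  exact h

open CutObserver in
/-- **CIL at level `j ≤ 2` for an observer whose Steiner neighbours are two-port pendant stars with pairwise distinct ports** (any number
of them, any relay neighbours, all `|A|`), witness an `H`-champion `q ∈ A` off the ports (`H = G − o`): `μ(1 ≤ |π(o)| ≤ j) ≤ μ(|π(q)| ≤ j)`.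
Hypotheses: every positive-weight non-relay neighbour `y` of `o` has, off `o`, positive pairs only to two distinct relays `p y ≠ p' y`;
ports of distinct such neighbours are distinct; `q` dominates every relay in `H`-lightness and is not a port.
[cite: VandenbergHaggstromKahn2005, Thm. 1.5 (p. 7); KozmaNitzan2024, Thm. 4 (pp. 13–14) — star transfer `cil_of_starStability`] -/
theorem cil_twoPortStars_levelTwo (w : Sym2 (Fin n) → unitInterval) (A : Finset (Fin n)) (o q : Fin n) (p p' : Fin n → Fin n)
    (j : ℕ) (hj : j ≤ 2) (hoA : o ∉ A) (hqA : q ∈ A)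
    (hnbrs : ∀ y : Fin n, y ≠ o → y ∉ A → w s(o, y) ≠ 0 →
      p y ∈ A ∧ p' y ∈ A ∧ p y ≠ p' y ∧ ∀ u : Fin n, u ≠ y → u ≠ o → w s(y, u) ≠ 0 → u = p y ∨ u = p' y)
    (hdis : ∀ y y' : Fin n, y ≠ o → y' ≠ o → y ∉ A → y' ∉ A → w s(o, y) ≠ 0 → w s(o, y') ≠ 0 → y ≠ y' →
      p y ≠ p y' ∧ p y ≠ p' y' ∧ p' y ≠ p y' ∧ p' y ≠ p' y')
    (hqp : ∀ y : Fin n, y ≠ o → y ∉ A → w s(o, y) ≠ 0 → q ≠ p y ∧ q ≠ p' y)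
    (hchamp : ∀ a ∈ A,
      (prodBernoulli w).real {ω : BondConfig (Fin n) |
          (A.filter fun z => (openGraph (ω ∩ {e | o ∉ e})).Reachable a z).card ≤ j} ≤
        (prodBernoulli w).real {ω : BondConfig (Fin n) |
          (A.filter fun z => (openGraph (ω ∩ {e | o ∉ e})).Reachable q z).card ≤ j}) :
    (prodBernoulli w).real {ω : BondConfig (Fin n) |
        1 ≤ (A.filter fun x => ω ∈ openConn o x).card ∧ (A.filter fun x => ω ∈ openConn o x).card ≤ j} ≤
      (prodBernoulli w).real {ω : BondConfig (Fin n) | (A.filter fun x => ω ∈ openConn q x).card ≤ j} := by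
  have hqo : q ≠ o := fun h => hoA (h ▸ hqA)
  refine cil_of_starStability w A o q j hoA hqo fun B hBne hB => ?_
  -- the weights of `H = G − o`
  set u : Sym2 (Fin n) → unitInterval := fun e => if e ∈ {e : Sym2 (Fin n) | o ∉ e} then w e else 0 with hu
  -- members of a light star are non-relay neighbours
  have hmem : ∀ y ∈ B, y ≠ o ∧ y ∉ A ∧ w s(o, y) ≠ 0 := by
    intro y hy
    obtain ⟨hyo, hwy, hlt⟩ := hB y hy
    refine ⟨hyo, fun hyA => ?_, hwy⟩
    exact absurd (hchamp y hyA) (not_le.2 hlt)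
  -- transport of lightness and of the two events to `H`
  have e1 : ∀ x : Fin n, {ω : BondConfig (Fin n) |
        (A.filter fun z => (openGraph (ω ∩ {e | o ∉ e})).Reachable x z).card ≤ j} =
      {ω : BondConfig (Fin n) | ω ∩ {e | o ∉ e} ∈
        {ξ : BondConfig (Fin n) | (A.filter fun z => ξ ∈ openConn x z).card ≤ j}} := by
    intro x; ext ω; simp only [mem_setOf_eq, filter_avoid_eq]
  have hdomH : ∀ x ∈ A, (prodBernoulli u).real {ξ : BondConfig (Fin n) | (A.filter fun z => ξ ∈ openConn x z).card ≤ j} ≤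
      (prodBernoulli u).real {ξ : BondConfig (Fin n) | (A.filter fun z => ξ ∈ openConn q z).card ≤ j} := by
    intro x hx
    have h := hchamp x hx
    rw [e1 x, e1 q, measureReal_preimage_avoid, measureReal_preimage_avoid] at h
    exact h
  have e2 : {ω : BondConfig (Fin n) |
        (∀ y ∈ B, ¬ (openGraph (ω ∩ {e | o ∉ e})).Reachable q y) ∧
          1 ≤ (A.filter fun z => ∃ y ∈ B, (openGraph (ω ∩ {e | o ∉ e})).Reachable y z).card ∧
          (A.filter fun z => ∃ y ∈ B, (openGraph (ω ∩ {e | o ∉ e})).Reachable y z).card ≤ j} =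
      {ω : BondConfig (Fin n) | ω ∩ {e | o ∉ e} ∈
        {ξ : BondConfig (Fin n) | (∀ x ∈ B, ξ ∉ openConn q x) ∧
          1 ≤ (A.filter fun z => ∃ x ∈ B, ξ ∈ openConn x z).card ∧
          (A.filter fun z => ∃ x ∈ B, ξ ∈ openConn x z).card ≤ j}} := by
    ext ω; simp only [mem_setOf_eq, filter_avoid_exists_eq]; exact Iff.rfl
  have e3 : {ω : BondConfig (Fin n) |
        (∀ y ∈ B, ¬ (openGraph (ω ∩ {e | o ∉ e})).Reachable q y) ∧
          (A.filter fun z => (openGraph (ω ∩ {e | o ∉ e})).Reachable q z).card ≤ j} =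
      {ω : BondConfig (Fin n) | ω ∩ {e | o ∉ e} ∈
        {ξ : BondConfig (Fin n) | (∀ x ∈ B, ξ ∉ openConn q x) ∧
          (A.filter fun z => ξ ∈ openConn q z).card ≤ j}} := by
    ext ω; simp only [mem_setOf_eq, filter_avoid_eq]; exact Iff.rfl
  rw [e2, e3, measureReal_preimage_avoid, measureReal_preimage_avoid]
  -- in `H` the light neighbours form a set of two-port pendant stars dominated by `q`
  have hu_oy : ∀ y v : Fin n, v = o → u s(y, v) = 0 := by
    intro y v hv
    simp only [hu, mem_setOf_eq]
    rw [if_neg (fun h => h (hv ▸ Sym2.mem_mk_right y v))]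
  have hu_off : ∀ y v : Fin n, y ≠ o → v ≠ o → u s(y, v) = w s(y, v) := by
    intro y v hy hv
    simp only [hu, mem_setOf_eq]
    rw [if_pos]
    intro h
    rcases Sym2.mem_iff.1 h with h | h
    · exact hy h.symm
    · exact hv h.symm
  refine setCS_twoPortStarSet_levelTwo u A B p p' q j hj (fun y hy => (hmem y hy).2.1)
    (fun y hy => ?_) (fun y hy v hvy hv => ?_) (fun y hy y' hy' hne => ?_) hqA (fun y hy => ?_) (fun y hy => ?_)
  · obtain ⟨hyo, hyA, hwy⟩ := hmem y hy
    obtain ⟨h1, h2, h3, -⟩ := hnbrs y hyo hyA hwy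
    exact ⟨h1, h2, h3⟩
  · obtain ⟨hyo, hyA, hwy⟩ := hmem y hy
    have hvo : v ≠ o := fun hvo => hv (hu_oy y v hvo)
    rw [hu_off y v hyo hvo] at hv
    exact (hnbrs y hyo hyA hwy).2.2.2 v hvy hvo hv
  · obtain ⟨hyo, hyA, hwy⟩ := hmem y hy
    obtain ⟨hyo', hyA', hwy'⟩ := hmem y' hy'
    exact hdis y y' hyo hyo' hyA hyA' hwy hwy' hne
  · obtain ⟨hyo, hyA, hwy⟩ := hmem y hy
    exact hqp y hyo hyA hwy
  · obtain ⟨hyo, hyA, hwy⟩ := hmem y hy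
    obtain ⟨h1, h2, -, -⟩ := hnbrs y hyo hyA hwy
    exact ⟨hdomH _ h1, hdomH _ h2⟩

end StarSet

end Summit.CriticalPhenomena.PercolationContinuityZ3.Theorems

end
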